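import Summits.QuantumFields.BalabanUV.T4Continuum.Support.CovariantLineSlot
import Summits.QuantumFields.BalabanUV.T4Continuum.Support.RegularTransportersExp

/-!
# T⁴ programme, spine node NE2 (U1a) — the UNITARITY binder `hR1` of the line presentation DISCHARGED for EXPONENTIAL TRANSPORTERS of
# skew-adjoint data (`U = e^{iηA}`, `A` Hermitian): `‖exp((L^k)⁻¹·X)‖ ≤ 1` for `Xᴴ = −X` (support row B3.a-vec-bond, file 4)

NE2 formalisation swarm, seat `b2b-balaban-t4-ne2-formalise-leaf-02` (GEN 2), on top of this seat's `Support/CovariantLineSlot` (p211047: the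
(γ) variant `tierB_rate_at_one_sharp_line` with binders `hreg`, `hR1 : ‖R‖ ≤ 1`, `hNE3`, `hP₄`, `hsmall`) and leaf-03's
`Support/RegularTransportersExp` (p208217: `expTransporters A k ν i = exp((L^k)⁻¹ • A k ν i)` and `regularTransporters_exp` — the (3.35)-shape
class from `‖A‖ ≤ α₁`, `‖A(x+e_μ) − A(x)‖ ≤ α₁/L^k`).  The one hypothesis row B5 does not carry, unitarity, is AUTOMATIC for the printed shape
`U = e^{iηA}` with `A` Hermitian, i.e. for SKEW-ADJOINT matrix data `X = iA`:
 * `norm_le_one_of_mem_unitary` (C⋆-identity `‖U⋆U‖ = ‖U‖²` in `M_o(ℂ)` with the `ℓ²`-operator norm), `exp_smul_mem_unitary_of_skew`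
   (Mathlib's `NormedSpace.exp_mem_unitary_of_mem_skewAdjoint`, real scalar `(L^k)⁻¹`), **`norm_expTransporters_le_one`**:
   `(∀ k ν i, star (X k ν i) = −X k ν i) → ‖expTransporters L M X k ν i‖ ≤ 1`;
 * **`tierB_rate_at_one_sharp_line_exp`**: the (γ) `t = 1` rate for `R = expTransporters X` with binders `hskew`, `hsize`, `hlip` (the data
   `X`), `hNE3` (B2 slot), `hP₄`, `hsmall` — `hreg` from leaf-03's `regularTransporters_exp` (constants `α₁e^{α₁}`), `hR1` from above.

HONEST FRAMING (T4-DAG p. 1).  Elementary (C⋆-identity + Mathlib's unitary exponential); MODEL LEVEL (the data `X` are hypotheses; nothing about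
Bałaban's minimisers or the existence of the regular gauge is asserted); variant (γ), NOT the (α) instance of record (c8), no identification (c5);
NE2 NOT proved; NOT infinite volume / mass gap / Clay / summit progress; spine 0/9 unchanged.  HONEST DEPENDENCY: continuum YM on T⁴ ⇐ BetaPertH ∧
nine spine estimates (0/9 proved); BetaPertH ⇐ (D1) ∧ (D4) ∧ CAP+tail; G-an2-4 gates asym, D1 and NE2/3/4.  ABSOLUTE RULE kept; no `sorry`.
-/

noncomputable section

open scoped BigOperators ComplexConjugate Matrix Matrix.Norms.L2Operator Kronecker
open NormedSpace

namespace Summit.QuantumFields.BalabanUV.T4Continuum.CovariantLineSlotExp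

open Literature.MathematicalPhysics.QuantumFieldTheory.Balaban1983to89.B5Prop11Plancherel (fine Tor Cst)
open Literature.MathematicalPhysics.QuantumFieldTheory.Balaban1983to89.B5G183RateUnitTower (lev lev_neZero)
open Literature.MathematicalPhysics.QuantumFieldTheory.Balaban1983to89.T4EtaRateMin (LocalRate)
open Summit.QuantumFields.BalabanUV.T4Continuum
open Summit.QuantumFields.BalabanUV.T4Continuum.BalabanAveragedTowerUnit (idx Qlev)
open Summit.QuantumFields.BalabanUV.T4Continuum.BackgroundResolventLaw (l2_opNorm_one_le)
open Summit.QuantumFields.BalabanUV.T4Continuum.BackgroundResolventTower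
open Summit.QuantumFields.BalabanUV.T4Continuum.KingPairingPlantedLaw
open Summit.QuantumFields.BalabanUV.T4Continuum.CovariantAveragingTower (TowerLimitRate)
open Summit.QuantumFields.BalabanUV.T4Continuum.KroneckerLift
open Summit.QuantumFields.BalabanUV.T4Continuum.BlockPairingGeometry (tau)
open Summit.QuantumFields.BalabanUV.T4Continuum.CovariantLineAveragingTower (kappaLine C2line)
open Summit.QuantumFields.BalabanUV.T4Continuum.CovariantLineTransporters (StepContours)
open Summit.QuantumFields.BalabanUV.T4Continuum.NE2FromNE3 (bgReadings)
open Summit.QuantumFields.BalabanUV.T4Continuum.RegularBackgroundTower (regClass)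
open Summit.QuantumFields.BalabanUV.T4Continuum.RegularTransportersExp (expTransporters regularTransporters_exp)
open Summit.QuantumFields.BalabanUV.T4Continuum.NE2BalabanLayer (tierBPert)
open Summit.QuantumFields.BalabanUV.T4Continuum.NE2BalabanLayerSharp (kappaBs C2Bs)
open Summit.QuantumFields.BalabanUV.T4Continuum.CovariantLineSlot

variable {d : ℕ} (L : ℕ) [NeZero L] (M : Fin d → ℕ) [hM : ∀ μ, NeZero (M μ)] (a : ℝ) (ha : 0 < a) {o : Type*} [Fintype o] [DecidableEq o]

/-! ## §1 Unitaries are contractions; exponentials of skew-adjoint data are unitary -/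

omit [NeZero L] hM in
/-- a unitary of `M_o(ℂ)` has `ℓ²`-operator norm `≤ 1` (`‖U⋆U‖ = ‖U‖²`, `‖1‖ ≤ 1`; also when `o` is empty). [folklore] -/
theorem norm_le_one_of_mem_unitary {U : Matrix o o ℂ} (hU : U ∈ unitary (Matrix o o ℂ)) : ‖U‖ ≤ 1 := by
  have h1 : star U * U = 1 := Unitary.star_mul_self_of_mem hU
  have h2 : ‖U‖ * ‖U‖ = ‖(1 : Matrix o o ℂ)‖ := by rw [← CStarRing.norm_star_mul_self, h1]
  have h3 : ‖(1 : Matrix o o ℂ)‖ ≤ 1 := l2_opNorm_one_le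
  nlinarith [norm_nonneg U]

omit [NeZero L] hM in
/-- the exponential of a real multiple of a skew-adjoint matrix is unitary (Mathlib's `exp_mem_unitary_of_mem_skewAdjoint`). [folklore] -/
theorem exp_smul_mem_unitary_of_skew {X : Matrix o o ℂ} (hX : star X = -X) (r : ℝ) :
    exp (((r : ℂ)) • X) ∈ unitary (Matrix o o ℂ) := by
  letI : NormedAlgebra ℚ (Matrix o o ℂ) := NormedAlgebra.restrictScalars ℚ ℂ (Matrix o o ℂ)
  refine exp_mem_unitary_of_mem_skewAdjoint (skewAdjoint.mem_iff.mpr ?_)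
  rw [star_smul, hX, smul_neg, Complex.star_def, Complex.conj_ofReal]

omit [NeZero L] hM in
/-- **EXPONENTIAL TRANSPORTERS OF SKEW-ADJOINT DATA ARE CONTRACTIONS**: `star X = −X ⟹ ‖exp((L^k)⁻¹ • X)‖ ≤ 1` — the binder `hR1` of the
line presentation for the printed shape `U = e^{iηA}` (`X = iA`, `A` Hermitian). [folklore] -/
theorem norm_expTransporters_le_one {X : (k : ℕ) → Fin d → (idx L M k → Matrix o o ℂ)} (hskew : ∀ k ν i, star (X k ν i) = -X k ν i)
    (k : ℕ) (ν : Fin d) (i : idx L M k) : ‖expTransporters L M X k ν i‖ ≤ 1 := by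
  refine norm_le_one_of_mem_unitary (o := o) ?_
  have e : ((((lev L k : ℕ) : ℂ))⁻¹ • X k ν i) = (((((lev L k : ℕ) : ℝ)⁻¹ : ℝ) : ℂ)) • X k ν i := by
    congr 1; push_cast; rfl
  show exp ((((lev L k : ℕ) : ℂ))⁻¹ • X k ν i) ∈ unitary (Matrix o o ℂ)
  rw [e]
  exact exp_smul_mem_unitary_of_skew (hskew k ν i) _

/-! ## §2 The (γ) root on exponential data -/

variable {Γ : StepContours L M} {ℓ : ℕ}

/-- **THE (γ) `t = 1` RATE FOR EXPONENTIAL TRANSPORTERS OF SMALL, LATTICE-LIPSCHITZ, SKEW-ADJOINT DATA** (`L ≥ 2`, `d ≥ 1`): binders `hskew`,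
`hsize : ‖X‖ ≤ α₁`, `hlip : ‖X(x+e_μ) − X(x)‖ ≤ α₁/L^k` (the (3.35)-shape data), `hNE3` (node NE3 BY NAME — B2 slot only), `hP₄` (row B4 slot),
`hsmall` (threshold on `(card o, d, a, L, ℓ, α₁e^{α₁}, κ₄)`).  `hreg` = leaf-03's `regularTransporters_exp`, `hR1` = §1.  Variant (γ), NOT the
instance of record; NE2 NOT proved by this.  (`[Nonempty o]` as in leaf-03's `regularTransporters_exp`.) [folklore] -/
theorem tierB_rate_at_one_sharp_line_exp [Nonempty o] (hL : 2 ≤ L) (hd : 1 ≤ d) (hΓ : ∀ j x, (Γ j x).length ≤ ℓ)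
    {X : (k : ℕ) → Fin d → (idx L M k → Matrix o o ℂ)} {α₁ : ℝ} (hα : 0 ≤ α₁) (hskew : ∀ k ν i, star (X k ν i) = -X k ν i)
    (hsize : ∀ k ν (i : idx L M k), ‖X k ν i‖ ≤ α₁)
    (hlip : ∀ k ν μ (i : idx L M k), ‖X k ν (tau (fine (lev L k) M) μ i) - X k ν i‖ ≤ α₁ / (lev L k : ℕ))
    {C : ℝ} (hC : 0 ≤ C) (hNE3 : LocalRate (bgReadings L M (regClass L M (expTransporters L M X))) C ((L : ℝ)⁻¹))
    {P₄ : (k : ℕ) → Matrix (idx L M k × o) (idx L M k × o) ℂ} {κ₄ C₄ : ℝ}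
    (hP₄ : PerturbationLaws (fun k => calDalev L M a ha k ⊗ₖ (1 : Matrix o o ℂ)) P₄ (fun k => JpcT L M k ⊗ₖ (1 : Matrix o o ℂ)) κ₄
      (fun k => C₄ * ((L : ℝ)⁻¹) ^ k))
    (hsmall : kappaBs o d a (α₁ * Real.exp α₁) (α₁ * Real.exp α₁)
      (kappaLine d L a (ℓ * (α₁ * Real.exp α₁) * (L : ℝ)⁻¹) (α₁ * Real.exp α₁) (a : ℂ)) κ₄ < 1) :
    TowerLimitRate (fun k => Qlev L M k ⊗ₖ (1 : Matrix o o ℂ)) ((L : ℝ) ^ d)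
      (fun k => (calDalev L M a ha k ⊗ₖ (1 : Matrix o o ℂ) + tierBPert L M (expTransporters L M X) (lineSlot L M a Γ (expTransporters L M X)) P₄ k)⁻¹)
      (Cpert (kappaBs o d a (α₁ * Real.exp α₁) (α₁ * Real.exp α₁)
          (kappaLine d L a (ℓ * (α₁ * Real.exp α₁) * (L : ℝ)⁻¹) (α₁ * Real.exp α₁) (a : ℂ)) κ₄) (2 * d * Cst d a) (CJ d a)
        (C2Bs o d L a (α₁ * Real.exp α₁) (α₁ * Real.exp α₁) C
          (C2line d L a (ℓ * (α₁ * Real.exp α₁) * (L : ℝ)⁻¹) (α₁ * Real.exp α₁) 0 (a : ℂ)) C₄) 0 1) ((L : ℝ)⁻¹) :=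
  tierB_rate_at_one_sharp_line L M a ha hL hd hΓ (regularTransporters_exp L M hα hsize hlip) (norm_expTransporters_le_one L M hskew) hC hNE3
    hP₄ hsmall

end Summit.QuantumFields.BalabanUV.T4Continuum.CovariantLineSlotExp

end
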